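import Summits.CriticalPhenomena.PercolationContinuityZ3.Theorems.SahiMasterFamilyLocalToGlobalAll
import Summits.CriticalPhenomena.PercolationContinuityZ3.Theorems.SahiMasterFamilyAllOrders
import Summits.CriticalPhenomena.PercolationContinuityZ3.Theorems.SahiMasterFamilyCoordPoly
import Summits.CriticalPhenomena.PercolationContinuityZ3.Theorems.PercNearOneGluingNoHeavyLowerTailSahiCombMasterFamily

/-!
# The POINTWISE equality conjecture after (EQI-k) at every order: zeros on open parameter sets, generic parameters,
# (M⁺-k) ⟹ (EQ-k), and (EQ-k) = strict positivity on irreducible families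

Unit `prim-master-conj` (crux anchor stmt-CriticalPhenomena-4575, helper work), gen 13.  Vocabulary: `SahiMasterFamily.lean`
(`sahiE` = Sahi's `E_k` [Sahi2008; LiebSahi2021, Def. 3.1], `bernoulliWeight p`, `ind`, the zero-flag class `Z_k = SuppZeroFlag k`,
`MasterFamilyEqIff k` = the POINTWISE conjecture "for `p` in the open cube, `E_k(μ_p; 1_U) = 0 ↔ U ∈ Z_k`", `MasterFamilyNonneg k` =
Sahi's `C_k` / Kahn's Conjecture 5 for product measures).  Gen 12 closed the IDENTICALLY-ZERO form at every order
(`GluedFrames.masterFamilyIdentEqIff_all : ∀ k, MasterFamilyIdentEqIff k`).  This file draws what that theorem gives for the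
pointwise conjecture, which itself stays OPEN (it contains Kahn's Conjecture 5, `SahiMasterFamilyEqImpliesNonneg`):

1. **Zeros on an open set of parameters** (`sahiE_eq_zero_of_isOpen`, every `k`, every family of real functions): if
   `E_k(μ_q; F) = 0` for all `q` in a nonempty open subset of the closed cube `[0,1]^ι` then `E_k(μ_q; F) = 0` for EVERY `q`
   (one coordinate at a time: along a coordinate `E_k` is a polynomial, `SahiMasterFamilyCoordPoly.sahiE_update_eq_eval`, and a
   polynomial with infinitely many roots vanishes).  Hence (`suppZeroFlag_of_eq_zero_on_open`, `sahiE_ind_eq_zero_on_open_iff`):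
   **for increasing events, `E_k(μ_q; 1_U)` vanishes on a nonempty open parameter set iff `U ∈ Z_k`** — the "locally identically
   zero" form of the master conjecture, at every order.
2. **Generic parameters** (`isOpen_goodParams`, `dense_goodParams`, `exists_mem_goodParams_of_isOpen`): for every finite `ι` and every `k` the set of parameter
   vectors `p ∈ [0,1]^ι` at which the pointwise statement "`E_k(μ_p; 1_U) = 0 ↔ U ∈ Z_k` for EVERY increasing `k`-family `U`"
   holds is OPEN and DENSE in the cube.  So `MasterFamilyEqIff k` can only fail on a closed nowhere-dense set of parameters.
3. **(M⁺-k) ⟹ (EQ-k)** (`masterFamilyEqIff_of_combPos`; per family `suppZeroFlag_of_combPos`, any multidegree): a tensor-Bernstein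
   certificate makes zeros density-free (`SahiComb.CombPos.eq_zero_of_interior`), and (EQI-k) turns "identically zero" into `Z_k`.
   So at every order the three master statements are now LINEARLY ORDERED: (M⁺-k) ⟹ (EQ-k) ⟹ (M-k)
   (`masterFamilyNonneg_of_masterFamilyEqIff`).
4. **(EQ-k) = strict positivity on irreducible families** (`masterFamilyEqIff_iff_pos`): `MasterFamilyEqIff (n+3)` holds iff every
   family of `n+3` increasing events with NO deleted sub-family in `Z_{n+2}` has `E_{n+3}(μ_p; 1_U) > 0` at every interior `p`
   (families WITH such a sub-family are settled pointwise by `masterFamily_step_all`); order 3: `E_3 > 0` on the open cube for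
   every pairwise-dependent triple (`masterFamilyEqIff_three_iff_pos`) — Kahn's Conjecture 5 in strict form off `Z_3`.
Nothing here asserts (EQ-k), (M-k) or (M⁺-k).  Axioms standard. [this work]
-/

noncomputable section

open scoped Classical

namespace Summit.CriticalPhenomena.PercolationContinuityZ3.Theorems

open Finset Function Topology
open Literature.Combinatorics.Sahi2008
open Literature.Probability.Percolation.DecisionTree (ind)

namespace Pointwise

/-! ### 1. Vanishing on an open set of parameters -/

section OpenSets

variable {ι : Type*} [Fintype ι]

/-- Along the coordinate `e`: if `E_n(μ_{p[e ↦ s]}; F) = 0` for all `s` in a non-degenerate interval `(a, b) ⊆ [0,1]`, the fibre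
polynomial `sahiEP (secPoly p e) n F` vanishes (infinitely many roots). [this work] -/
theorem sahiEP_eq_zero_of_forall_Ioo (p : ι → unitInterval) (e : ι) (n : ℕ) (F : Fin n → Set ι → ℝ) {a b : ℝ}
    (hab : a < b) (ha : 0 ≤ a) (hb : b ≤ 1)
    (h : ∀ s : unitInterval, (s : ℝ) ∈ Set.Ioo a b → sahiE (bernoulliWeight (update p e s)) n F = 0) :
    sahiEP (secPoly p e) n F = 0 := by
  refine Polynomial.eq_zero_of_infinite_isRoot _ ((Set.Ioo_infinite hab).mono fun x hx => ?_)
  have hx01 : x ∈ Set.Icc (0 : ℝ) 1 := ⟨ha.trans hx.1.le, hx.2.le.trans hb⟩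
  rw [Set.mem_setOf_eq, Polynomial.IsRoot.def, ← h ⟨x, hx01⟩ hx, sahiE_update_eq_eval]

/-- Hence `E_n(μ_{p[e ↦ s]}; F) = 0` for EVERY `s ∈ [0,1]`. [this work] -/
theorem sahiE_update_eq_zero_of_forall_Ioo (p : ι → unitInterval) (e : ι) (n : ℕ) (F : Fin n → Set ι → ℝ) {a b : ℝ}
    (hab : a < b) (ha : 0 ≤ a) (hb : b ≤ 1)
    (h : ∀ s : unitInterval, (s : ℝ) ∈ Set.Ioo a b → sahiE (bernoulliWeight (update p e s)) n F = 0) (s : unitInterval) :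
    sahiE (bernoulliWeight (update p e s)) n F = 0 := by
  rw [sahiE_update_eq_eval, sahiEP_eq_zero_of_forall_Ioo p e n F hab ha hb h, Polynomial.eval_zero]

/-- **Vanishing on a box forces vanishing everywhere**: if `E_n(μ_q; F) = 0` for every `q` in a non-degenerate box
`∏_e (a_e, b_e) ⊆ [0,1]^ι`, then `E_n(μ_q; F) = 0` for every `q ∈ [0,1]^ι` (free the coordinates one at a time). [this work] -/
theorem sahiE_eq_zero_of_forall_paramBox (n : ℕ) (F : Fin n → Set ι → ℝ) {a b : ι → ℝ} (hab : ∀ e, a e < b e)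
    (ha : ∀ e, 0 ≤ a e) (hb : ∀ e, b e ≤ 1)
    (h : ∀ q : ι → unitInterval, (∀ e, (q e : ℝ) ∈ Set.Ioo (a e) (b e)) → sahiE (bernoulliWeight q) n F = 0)
    (q : ι → unitInterval) : sahiE (bernoulliWeight q) n F = 0 := by
  suffices key : ∀ (S : Finset ι) (q : ι → unitInterval), (∀ e, e ∉ S → (q e : ℝ) ∈ Set.Ioo (a e) (b e)) →
      sahiE (bernoulliWeight q) n F = 0 from key univ q fun e he => absurd (mem_univ e) he
  intro S
  induction S using Finset.induction_on with
  | empty => exact fun q hq => h q fun e => hq e (by simp)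
  | insert e S _ ih =>
    intro q hq
    have hfib : ∀ s : unitInterval, (s : ℝ) ∈ Set.Ioo (a e) (b e) → sahiE (bernoulliWeight (update q e s)) n F = 0 := by
      intro s hs
      refine ih (update q e s) fun e' he' => ?_
      by_cases hee : e' = e
      · subst hee; rw [update_self]; exact hs
      · rw [update_of_ne hee]
        exact hq e' (by simp [hee, he'])
    have h0 := sahiE_update_eq_zero_of_forall_Ioo q e n F (hab e) (ha e) (hb e) hfib (q e)
    rwa [update_eq_self] at h0

/-- **Vanishing on a nonempty open set of parameters forces vanishing everywhere** (every `k`, every family of real functions).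
[this work] -/
theorem sahiE_eq_zero_of_isOpen (n : ℕ) (F : Fin n → Set ι → ℝ) {W : Set (ι → unitInterval)} (hW : IsOpen W)
    (hne : W.Nonempty) (h : ∀ q ∈ W, sahiE (bernoulliWeight q) n F = 0) (q : ι → unitInterval) :
    sahiE (bernoulliWeight q) n F = 0 := by
  obtain ⟨q₀, hq₀⟩ := hne
  obtain ⟨ε, hε, hball⟩ := Metric.isOpen_iff.1 hW q₀ hq₀
  set a : ι → ℝ := fun e => max ((q₀ e : ℝ) - ε / 2) 0 with hadef
  set b : ι → ℝ := fun e => min ((q₀ e : ℝ) + ε / 2) 1 with hbdef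
  have hab : ∀ e, a e < b e := by
    intro e
    have h0 := (q₀ e).2.1
    have h1 := (q₀ e).2.2
    simp only [hadef, hbdef, max_lt_iff, lt_min_iff]
    refine ⟨⟨by linarith, by linarith⟩, by linarith, zero_lt_one⟩
  refine sahiE_eq_zero_of_forall_paramBox n F hab (fun e => le_max_right _ _) (fun e => min_le_right _ _)
    (fun q' hq' => h q' (hball ?_)) q
  rw [Metric.mem_ball, dist_pi_lt_iff hε]
  intro e
  have he := hq' e
  simp only [hadef, hbdef, Set.mem_Ioo, max_lt_iff, lt_min_iff] at he
  rw [Subtype.dist_eq, Real.dist_eq, abs_lt]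
  constructor <;> linarith [he.1.1, he.2.1]

end OpenSets

/-! ### 1'. Increasing events: locally identically zero `↔ Z_k` (via (EQI-k) at every order) -/

section Events

variable {ι : Type} [Fintype ι]

/-- **Zero on a nonempty open parameter set ⟹ `Z_k`** (every `k`; uses `GluedFrames.masterFamilyIdentEqIff_all`). [this work] -/
theorem suppZeroFlag_of_eq_zero_on_open {k : ℕ} (U : Fin k → Set (Set ι)) (hU : ∀ j, IsUpperSet (U j))
    {W : Set (ι → unitInterval)} (hW : IsOpen W) (hne : W.Nonempty)
    (h : ∀ q ∈ W, sahiE (bernoulliWeight q) k (fun j => ind (U j)) = 0) : SuppZeroFlag k U :=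
  (GluedFrames.masterFamilyIdentEqIff_all k ι U hU).1 fun p _ => sahiE_eq_zero_of_isOpen k _ hW hne h p

/-- **The locally-identically-zero form of the master conjecture, every order**: for increasing `U`,
`E_k(μ_q; 1_U)` vanishes on some nonempty open set of parameters iff `U ∈ Z_k` (iff it vanishes for every `q`). [this work] -/
theorem sahiE_ind_eq_zero_on_open_iff {k : ℕ} (U : Fin k → Set (Set ι)) (hU : ∀ j, IsUpperSet (U j)) :
    (∃ W : Set (ι → unitInterval), IsOpen W ∧ W.Nonempty ∧ ∀ q ∈ W, sahiE (bernoulliWeight q) k (fun j => ind (U j)) = 0) ↔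
      SuppZeroFlag k U := by
  refine ⟨fun ⟨W, hW, hne, h⟩ => suppZeroFlag_of_eq_zero_on_open U hU hW hne h, fun hZ => ?_⟩
  exact ⟨Set.univ, isOpen_univ, ⟨fun _ => 0, Set.mem_univ _⟩, fun q _ => masterFamilyEqIff_mpr k ι q U hZ⟩

/-- Zero on a box ⟹ `Z_k`. [this work] -/
theorem suppZeroFlag_of_eq_zero_on_paramBox {k : ℕ} (U : Fin k → Set (Set ι)) (hU : ∀ j, IsUpperSet (U j)) {a b : ι → ℝ}
    (hab : ∀ e, a e < b e) (ha : ∀ e, 0 ≤ a e) (hb : ∀ e, b e ≤ 1)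
    (h : ∀ q : ι → unitInterval, (∀ e, (q e : ℝ) ∈ Set.Ioo (a e) (b e)) → sahiE (bernoulliWeight q) k (fun j => ind (U j)) = 0) :
    SuppZeroFlag k U :=
  (GluedFrames.masterFamilyIdentEqIff_all k ι U hU).1 fun p _ => sahiE_eq_zero_of_forall_paramBox k _ hab ha hb h p

/-! ### 2. Generic parameters: (EQ-k) holds on an open dense set of `p` -/

/-- The GOOD PARAMETER SET `{p | ∀ increasing U, E_k(μ_p; 1_U) = 0 ↔ U ∈ Z_k}` is the intersection over all families of the
per-family good sets `{p | U increasing → (E_k(μ_p; 1_U) = 0 ↔ U ∈ Z_k)}`. [this work] -/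
theorem goodParams_eq_iInter (k : ℕ) :
    {p : ι → unitInterval | ∀ U : Fin k → Set (Set ι), (∀ j, IsUpperSet (U j)) →
        (sahiE (bernoulliWeight p) k (fun j => ind (U j)) = 0 ↔ SuppZeroFlag k U)} =
      ⋂ U : Fin k → Set (Set ι), {p : ι → unitInterval | (∀ j, IsUpperSet (U j)) →
        (sahiE (bernoulliWeight p) k (fun j => ind (U j)) = 0 ↔ SuppZeroFlag k U)} := by
  ext p; simp only [Set.mem_setOf_eq, Set.mem_iInter]

/-- Off `Z_k`, the per-family good set is the non-vanishing set; on `Z_k` (or for non-increasing families) it is everything. [this work] -/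
theorem goodFor_eq (k : ℕ) (U : Fin k → Set (Set ι)) :
    {p : ι → unitInterval | (∀ j, IsUpperSet (U j)) → (sahiE (bernoulliWeight p) k (fun j => ind (U j)) = 0 ↔ SuppZeroFlag k U)} =
      if (∀ j, IsUpperSet (U j)) ∧ ¬ SuppZeroFlag k U then
        {p | sahiE (bernoulliWeight p) k (fun j => ind (U j)) ≠ 0} else Set.univ := by
  ext p
  simp only [Set.mem_setOf_eq]
  split_ifs with h
  · simp only [Set.mem_setOf_eq]
    exact ⟨fun hp h0 => h.2 ((hp h.1).1 h0), fun hp _ => ⟨fun h0 => absurd h0 hp, fun hZ => absurd hZ h.2⟩⟩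
  · simp only [Set.mem_univ, iff_true]
    intro hU
    have hZ : SuppZeroFlag k U := by
      by_contra hZ; exact h ⟨hU, hZ⟩
    exact ⟨fun _ => hZ, fun _ => masterFamilyEqIff_mpr k ι p U hZ⟩

/-- Each per-family good set is open. [this work] -/
theorem isOpen_goodFor (k : ℕ) (U : Fin k → Set (Set ι)) :
    IsOpen {p : ι → unitInterval | (∀ j, IsUpperSet (U j)) →
      (sahiE (bernoulliWeight p) k (fun j => ind (U j)) = 0 ↔ SuppZeroFlag k U)} := by
  rw [goodFor_eq]
  split_ifs
  · exact isOpen_ne_fun (continuous_sahiE_bernoulliWeight k _) continuous_const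
  · exact isOpen_univ

/-- Each per-family good set is dense (an increasing family whose `E_k` vanished on a nonempty open set would lie in `Z_k`). [this work] -/
theorem dense_goodFor (k : ℕ) (U : Fin k → Set (Set ι)) :
    Dense {p : ι → unitInterval | (∀ j, IsUpperSet (U j)) →
      (sahiE (bernoulliWeight p) k (fun j => ind (U j)) = 0 ↔ SuppZeroFlag k U)} := by
  rw [goodFor_eq]
  split_ifs with h
  · refine dense_iff_inter_open.2 fun W hW hne => ?_
    by_contra hempty
    rw [Set.not_nonempty_iff_eq_empty] at hempty
    have hzero : ∀ q ∈ W, sahiE (bernoulliWeight q) k (fun j => ind (U j)) = 0 := by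
      intro q hq
      by_contra hq0
      have : q ∈ W ∩ {p | sahiE (bernoulliWeight p) k (fun j => ind (U j)) ≠ 0} := ⟨hq, hq0⟩
      rw [hempty] at this
      exact this
    exact h.2 (suppZeroFlag_of_eq_zero_on_open U h.1 hW hne hzero)
  · exact dense_univ

/-- **The good parameter set is open.** [this work] -/
theorem isOpen_goodParams (ι : Type) [Fintype ι] (k : ℕ) :
    IsOpen {p : ι → unitInterval | ∀ U : Fin k → Set (Set ι), (∀ j, IsUpperSet (U j)) →
      (sahiE (bernoulliWeight p) k (fun j => ind (U j)) = 0 ↔ SuppZeroFlag k U)} := by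
  rw [goodParams_eq_iInter]
  exact isOpen_iInter_of_finite fun U => isOpen_goodFor k U

/-- **The good parameter set is dense**: (EQ-k) on `ι` holds, simultaneously for all increasing `k`-families, on a dense open set
of parameter vectors; it can only fail on a closed nowhere-dense set. [this work] -/
theorem dense_goodParams (ι : Type) [Fintype ι] (k : ℕ) :
    Dense {p : ι → unitInterval | ∀ U : Fin k → Set (Set ι), (∀ j, IsUpperSet (U j)) →
      (sahiE (bernoulliWeight p) k (fun j => ind (U j)) = 0 ↔ SuppZeroFlag k U)} := by
  set G : (Fin k → Set (Set ι)) → Set (ι → unitInterval) := fun U =>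
    {p : ι → unitInterval | (∀ j, IsUpperSet (U j)) →
      (sahiE (bernoulliWeight p) k (fun j => ind (U j)) = 0 ↔ SuppZeroFlag k U)} with hGdef
  have key : ∀ 𝓕 : Finset (Fin k → Set (Set ι)), Dense (⋂ U ∈ 𝓕, G U) := by
    intro 𝓕
    induction 𝓕 using Finset.induction_on with
    | empty => simp [dense_univ]
    | insert V 𝓕 _ ih =>
      rw [Finset.set_biInter_insert]
      exact (dense_goodFor k V).inter_of_isOpen_left ih (isOpen_goodFor k V)
  have e : {p : ι → unitInterval | ∀ U : Fin k → Set (Set ι), (∀ j, IsUpperSet (U j)) →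
      (sahiE (bernoulliWeight p) k (fun j => ind (U j)) = 0 ↔ SuppZeroFlag k U)} =
      ⋂ U ∈ (univ : Finset (Fin k → Set (Set ι))), G U := by
    rw [goodParams_eq_iInter]; simp [hGdef]
  rw [e]; exact key univ

/-- Quotable form: every nonempty open set of parameters contains a (necessarily interior) `p` at which
`E_k(μ_p; 1_U) = 0 ↔ U ∈ Z_k` for every increasing `k`-family `U` on `ι`. [this work] -/
theorem exists_mem_goodParams_of_isOpen (k : ℕ) {W : Set (ι → unitInterval)} (hW : IsOpen W) (hne : W.Nonempty) :
    ∃ p ∈ W, ∀ U : Fin k → Set (Set ι), (∀ j, IsUpperSet (U j)) →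
      (sahiE (bernoulliWeight p) k (fun j => ind (U j)) = 0 ↔ SuppZeroFlag k U) := by
  obtain ⟨p, hpW, hp⟩ := (dense_goodParams ι k).inter_open_nonempty W hW hne
  exact ⟨p, hpW, hp⟩

/-! ### 3. (M⁺-k) ⟹ (EQ-k): comb certificates make the zero locus pointwise -/

/-- **A comb (tensor-Bernstein) certificate of ANY multidegree makes (EQ-k) pointwise for the family**: if
`p ↦ E_k(μ_p; 1_U)` is comb-positive and vanishes at one interior `q`, then `U ∈ Z_k`. [this work] -/
theorem suppZeroFlag_of_combPos {k : ℕ} {U : Fin k → Set (Set ι)} (hU : ∀ j, IsUpperSet (U j)) {c : ι → ℕ}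
    (hC : SahiComb.CombPos c (fun p => sahiE (bernoulliWeight p) k (fun j => ind (U j)))) {q : ι → unitInterval}
    (hq : ∀ e, (q e : ℝ) ∈ Set.Ioo (0 : ℝ) 1) (h0 : sahiE (bernoulliWeight q) k (fun j => ind (U j)) = 0) :
    SuppZeroFlag k U :=
  (GluedFrames.masterFamilyIdentEqIff_all k ι U hU).1 fun p _ => hC.eq_zero_of_interior hq h0 p

/-- The pointwise zero locus of a comb-certified family: `E_k(μ_q; 1_U) = 0 ↔ U ∈ Z_k` at every interior `q`. [this work] -/
theorem sahiE_ind_eq_zero_iff_of_combPos {k : ℕ} {U : Fin k → Set (Set ι)} (hU : ∀ j, IsUpperSet (U j)) {c : ι → ℕ}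
    (hC : SahiComb.CombPos c (fun p => sahiE (bernoulliWeight p) k (fun j => ind (U j)))) {q : ι → unitInterval}
    (hq : ∀ e, (q e : ℝ) ∈ Set.Ioo (0 : ℝ) 1) :
    sahiE (bernoulliWeight q) k (fun j => ind (U j)) = 0 ↔ SuppZeroFlag k U :=
  ⟨suppZeroFlag_of_combPos hU hC hq, masterFamilyEqIff_mpr k ι q U⟩

/-- A comb-certified family outside `Z_k` has `E_k > 0` throughout the open cube. [this work] -/
theorem sahiE_ind_pos_of_combPos {k : ℕ} {U : Fin k → Set (Set ι)} (hU : ∀ j, IsUpperSet (U j)) {c : ι → ℕ}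
    (hC : SahiComb.CombPos c (fun p => sahiE (bernoulliWeight p) k (fun j => ind (U j)))) (hZ : ¬ SuppZeroFlag k U)
    {q : ι → unitInterval} (hq : ∀ e, (q e : ℝ) ∈ Set.Ioo (0 : ℝ) 1) :
    0 < sahiE (bernoulliWeight q) k (fun j => ind (U j)) :=
  lt_of_le_of_ne (hC.nonneg q) fun h => hZ (suppZeroFlag_of_combPos hU hC hq h.symm)

end Events

/-- **(M⁺-k) ⟹ (EQ-k), every order**: comb (tensor-Bernstein) positivity of `E_k` on product measures implies the POINTWISE
equality conjecture.  With `masterFamilyNonneg_of_masterFamilyEqIff` ((EQ-k) ⟹ (M-k)) the three master statements are linearly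
ordered at every order: (M⁺-k) ⟹ (EQ-k) ⟹ (M-k). [this work] -/
theorem masterFamilyEqIff_of_combPos {k : ℕ} (h : MasterFamilyCombPos k) : MasterFamilyEqIff k :=
  fun ι _ _ hq U hU => sahiE_ind_eq_zero_iff_of_combPos hU (h ι U hU) hq

/-- All orders at once. [this work] -/
theorem masterFamilyEqIff_all_of_combPos_all (h : ∀ k, MasterFamilyCombPos k) : ∀ k, MasterFamilyEqIff k :=
  fun k => masterFamilyEqIff_of_combPos (h k)

/-- The chain (M⁺-k) ⟹ (EQ-k) ⟹ (M-k), recorded. [this work] -/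
theorem masterFamily_chain (k : ℕ) :
    (MasterFamilyCombPos k → MasterFamilyEqIff k) ∧ (MasterFamilyEqIff k → MasterFamilyNonneg k) :=
  ⟨masterFamilyEqIff_of_combPos, masterFamilyNonneg_of_masterFamilyEqIff⟩

/-! ### 4. (EQ-k) = strict positivity on irreducible families -/

/-- **(EQ-(n+3)) ⟺ strict positivity on irreducible families**: the pointwise equality conjecture at order `n + 3` holds iff every
family of `n + 3` increasing events none of whose deleted sub-families lies in `Z_{n+2}` has `E_{n+3}(μ_p; 1_U) > 0` at every
interior `p`.  (Families with a `Z_{n+2}` sub-family are settled pointwise and unconditionally by `masterFamily_step_all`; the sign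
comes from `sahiE_ind_nonneg_of_masterFamilyEqIff`.) [this work] -/
theorem masterFamilyEqIff_iff_pos (n : ℕ) :
    MasterFamilyEqIff (n + 3) ↔ ∀ (ι : Type) [Fintype ι] (p : ι → unitInterval), (∀ e, (p e : ℝ) ∈ Set.Ioo (0 : ℝ) 1) →
      ∀ U : Fin (n + 3) → Set (Set ι), (∀ j, IsUpperSet (U j)) →
        (∀ m : Fin (n + 3), ¬ SuppZeroFlag (n + 2) (fun j => U (m.succAbove j))) →
          0 < sahiE (bernoulliWeight p) (n + 3) (fun j => ind (U j)) := by
  constructor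
  · intro hE ι _ p hp U hU hno
    refine lt_of_le_of_ne (sahiE_ind_nonneg_of_masterFamilyEqIff hE p hp U hU) fun h0 => ?_
    obtain ⟨m, hm, -⟩ := (hE ι p hp U hU).1 h0.symm
    exact hno m hm
  · intro hP
    rw [masterFamilyEqIff_iff_zero_forces_flag]
    intro ι _ p hp U hU h0
    by_contra hno
    push Not at hno
    exact (hP ι p hp U hU hno).ne' h0

/-- **Order 3**: (EQ-3) ⟺ "`E_3(μ_p; 1_A, 1_B, 1_C) > 0` at every interior `p` for every triple of increasing events with no
independent pair" — Kahn's Conjecture 5 in strict form off `Z_3`. [this work] -/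
theorem masterFamilyEqIff_three_iff_pos :
    MasterFamilyEqIff 3 ↔ ∀ (ι : Type) [Fintype ι] (p : ι → unitInterval), (∀ e, (p e : ℝ) ∈ Set.Ioo (0 : ℝ) 1) →
      ∀ U : Fin 3 → Set (Set ι), (∀ j, IsUpperSet (U j)) →
        (∀ m : Fin 3, ¬ SuppZeroFlag 2 (fun j => U (m.succAbove j))) →
          0 < sahiE (bernoulliWeight p) 3 (fun j => ind (U j)) :=
  masterFamilyEqIff_iff_pos 0

/-- Every order at once: the pointwise master conjecture is exactly "strict Sahi positivity on irreducible families of product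
measures, every order `≥ 3`" (orders `≤ 2` are theorems: `masterFamilyEqIff_zero/one/two`). [this work] -/
theorem masterFamilyEqIff_all_iff_pos_all :
    (∀ k, MasterFamilyEqIff k) ↔ ∀ (n : ℕ) (ι : Type) [Fintype ι] (p : ι → unitInterval), (∀ e, (p e : ℝ) ∈ Set.Ioo (0 : ℝ) 1) →
      ∀ U : Fin (n + 3) → Set (Set ι), (∀ j, IsUpperSet (U j)) →
        (∀ m : Fin (n + 3), ¬ SuppZeroFlag (n + 2) (fun j => U (m.succAbove j))) →
          0 < sahiE (bernoulliWeight p) (n + 3) (fun j => ind (U j)) := by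
  refine ⟨fun h n => (masterFamilyEqIff_iff_pos n).1 (h (n + 3)), fun h k => ?_⟩
  match k with
  | 0 => exact masterFamilyEqIff_zero
  | 1 => exact masterFamilyEqIff_one
  | 2 => exact masterFamilyEqIff_two
  | n + 3 => exact (masterFamilyEqIff_iff_pos n).2 (h n)

end Pointwise

end Summit.CriticalPhenomena.PercolationContinuityZ3.Theorems
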